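/- Ideator `ym-idea-2` (g15), route `AllWindowsColdBox`, residual ⟨stmt-QuantumFields-24004⟩ `BoxHighWindowsSU22`: the T-RESPECTING CURRENCY of the
wall memo HOME ideators/ym-idea-2/l22/HIGH-WINDOWS-WALL-g15.md §1/§8(c).  Helper; lands `--supports stmt-QuantumFields-24004`. -/
import Summits.QuantumFields.YangMills.Theorems.AllWindowsColdBoxBoxMidOfDominationAbs
import Summits.QuantumFields.YangMills.Theorems.WeakCouplingRatesBulkDominatesColdBoxWDirKernelTwoPoint
import Summits.QuantumFields.YangMills.Theorems.WeakCouplingRatesColdBoxTwoPointFloorWStubBoxKernelVsLattice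

/-!
# Route `AllWindowsColdBox`: the RELATIVE (T-respecting) sandwich — a one-sided relative one-scale comparison gives the box windows with NO exponent condition

The landed sandwich `boxTwoPointDomination_of_abs_at` takes an ABSOLUTE comparison `|β²·boxPlaqCov − (D/4)·boxDirCircSqCov| ≤ β^{−κ}` and needs
`κ > 8θ` (the floor `boxDirCircSqCov ⌈β^θ⌉ ⌈β^A⌉ ≳ β^{−8A}` must beat the error), so a method whose error is `K·H^a·β^{−b}` is booked only for
`θ < b/(a+9)` (wall memo §1: LINE-17's `H⁶/β` ⇒ `1/15`; a Landau-gauge `(log H)^m/β` ⇒ `1/9`).  A method whose error DECAYS IN `T` like the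
main term — i.e. which proves, eventually in `β`, the one-sided RELATIVE bound `η · boxDirCircSqCov ⌈β^θ⌉ ⌈β^A⌉ ≤ β² · boxPlaqCov ρ β ⌈β^θ⌉ ⌈β^A⌉`
for some `η > 0` — is booked on its whole validity range: `boxTwoPointDomination_of_relDir_at` (any compact `G`, any `ρ`, any `0 < A < θ`,
no `κ`), and the ceiling form `boxWindow_of_dirichletDominationRel_ceiling`.  Proof: Dirichlet Wick `boxDirCircSqCov = 2·boxDirichletPlaqCov²`
(`boxDirCircSqCov_eq_two_mul_sq`), the Dirichlet kernel floor `boxDirichletPlaqCov H T ≥ 1/(4π²T⁴)` for `T ≤ H/(8M)`, `T ≥ L`, `H ≥ 32`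
(`boxDirichletPlaqCov_ge`), and the curvature asymptotics `|C(T)| ≤ (1/π² + K)/T⁴` (`exists_curvaturePlaquetteCorr_asymp`); the exponent
bookkeeping `T = ⌈β^A⌉`, `H = ⌈β^θ⌉` is that of `stub_boxKernelVsLattice`.
No sorry; no definition; standard axioms.  NOT the Yang–Mills mass gap: finite-volume bookkeeping at rung level (R2ξ″); it proves no comparison.
-/

set_option autoImplicit false

noncomputable section

open MeasureTheory Real
open Literature.MathematicalPhysics.QuantumLattice
open Literature.MathematicalPhysics.QuantumFieldTheory
open Summit.QuantumFields.YangMills.Theorems.WeakCouplingRates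

namespace Summit.QuantumFields.YangMills.Theorems.AllWindowsColdBox

/-- **Relative sandwich.**  For every compact `G`, representation `ρ`, window `0 < A < θ` and `η > 0`: an eventual one-sided relative comparison
`η·boxDirCircSqCov ⌈β^θ⌉ ⌈β^A⌉ ≤ β²·boxPlaqCov ρ β ⌈β^θ⌉ ⌈β^A⌉` gives `BoxTwoPointDomination ρ A θ c` for an explicit `c > 0`.  No exponent condition. -/
theorem boxTwoPointDomination_of_relDir_at {N : ℕ} {G : Type*} [Group G] [TopologicalSpace G] [IsTopologicalGroup G]
    [CompactSpace G] [MeasurableSpace G] [BorelSpace G] (ρ : G →* Matrix (Fin N) (Fin N) ℂ) {A θ η : ℝ}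
    (hη : 0 < η) (hA : 0 < A) (hAθ : A < θ)
    (hrel : ∃ β₁ : ℝ, ∀ β : ℝ, β₁ ≤ β →
      η * boxDirCircSqCov ⌈β ^ θ⌉₊ ⌈β ^ A⌉₊ ≤ β ^ 2 * boxPlaqCov ρ β ⌈β ^ θ⌉₊ ⌈β ^ A⌉₊) :
    ∃ c : ℝ, 0 < c ∧ BoxTwoPointDomination ρ A θ c := by
  obtain ⟨β₁, h₁⟩ := hrel
  obtain ⟨M, L, hM1, hL1, hfloor⟩ := boxDirichletPlaqCov_ge
  obtain ⟨K_C, hKC0, hC⟩ := exists_curvaturePlaquetteCorr_asymp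
  have hθ : 0 < θ := hA.trans hAθ
  have hθA : 0 < θ - A := by linarith
  -- the constant: `c · C(T)² ≤ η · 2 · (1/(4π²T⁴))²` whenever `|C(T)| ≤ (1/π² + K_C)/T⁴`
  set κ₀ : ℝ := 1 / π ^ 2 + K_C with hκ₀
  have hκ₀pos : 0 < κ₀ := by positivity
  set c : ℝ := η / (8 * π ^ 4 * κ₀ ^ 2) with hc
  have hcpos : 0 < c := by positivity
  set β₀ : ℝ := max (max (max 1 β₁) ((32 : ℝ) ^ (1 / θ))) (max ((16 * M) ^ (1 / (θ - A))) (L ^ (1 / A))) with hβ₀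
  refine ⟨c, hcpos, β₀, fun β hβ => ?_⟩
  have hβ1 : 1 ≤ β := le_trans (le_trans (le_trans (le_max_left _ _) (le_max_left _ _)) (le_max_left _ _)) hβ
  have hββ₁ : β₁ ≤ β := le_trans (le_trans (le_trans (le_max_right _ _) (le_max_left _ _)) (le_max_left _ _)) hβ
  have hβ0 : 0 ≤ β := by linarith
  -- the powers of `β`
  have hθpow : (32 : ℝ) ≤ β ^ θ :=
    le_rpow_of_root_le (by norm_num) hθ (le_trans (le_trans (le_max_right _ _) (le_max_left _ _)) hβ)
  have hdiff : 16 * M ≤ β ^ (θ - A) :=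
    le_rpow_of_root_le (by positivity) hθA (le_trans (le_trans (le_max_left _ _) (le_max_right _ _)) hβ)
  have hApow : L ≤ β ^ A :=
    le_rpow_of_root_le (by positivity) hA (le_trans (le_trans (le_max_right _ _) (le_max_right _ _)) hβ)
  have hA1 : 1 ≤ β ^ A := hL1.trans hApow
  have hsplit : β ^ θ = β ^ (θ - A) * β ^ A := by
    rw [← Real.rpow_add (by linarith)]; ring_nf
  -- `T` and `H`
  set T : ℕ := ⌈β ^ A⌉₊ with hT
  set H : ℕ := ⌈β ^ θ⌉₊ with hH
  have hT_ge : β ^ A ≤ (T : ℝ) := Nat.le_ceil _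
  have hT_lt : (T : ℝ) < β ^ A + 1 := Nat.ceil_lt_add_one (by positivity)
  have hT_le : (T : ℝ) ≤ 2 * β ^ A := by linarith
  have hH_ge : β ^ θ ≤ (H : ℝ) := Nat.le_ceil _
  have hT1 : 1 ≤ T := by
    have : (1 : ℝ) ≤ T := hA1.trans hT_ge
    exact_mod_cast this
  have hT0 : (0 : ℝ) < T := by exact_mod_cast hT1
  have hH32 : (32 : ℝ) ≤ H := hθpow.trans hH_ge
  -- `M · T ≤ H/8` and `L ≤ T`
  have hHT : M * (T : ℝ) ≤ (H : ℝ) / 8 := by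
    have h1 : M * (T : ℝ) ≤ M * (2 * β ^ A) := mul_le_mul_of_nonneg_left hT_le (by linarith)
    have h2 : 16 * M * β ^ A ≤ β ^ (θ - A) * β ^ A := mul_le_mul_of_nonneg_right hdiff (by linarith)
    rw [← hsplit] at h2
    linarith
  have hLT : L ≤ (T : ℝ) := hApow.trans hT_ge
  -- the Dirichlet floor and the curvature ceiling at `T`
  have hP : 1 / (4 * π ^ 2) / (T : ℝ) ^ 4 ≤ boxDirichletPlaqCov H T := hfloor H hH32 T hHT hLT
  have hPpos : 0 < 1 / (4 * π ^ 2) / (T : ℝ) ^ 4 := by positivity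
  have hCabs : |@Literature.MathematicalPhysics.QuantumFieldTheory.curvaturePlaquetteCorr 4 (by norm_num) (T : ℤ)| ≤ κ₀ / (T : ℝ) ^ 4 := by
    have hasy := hC T hT1
    have hT4 : (0 : ℝ) < (T : ℝ) ^ 4 := by positivity
    have hKT : K_C / (T : ℝ) ^ 5 ≤ K_C / (T : ℝ) ^ 4 := by
      apply div_le_div_of_nonneg_left hKC0 hT4
      have hT1' : (1 : ℝ) ≤ T := by exact_mod_cast hT1
      calc (T : ℝ) ^ 4 = (T : ℝ) ^ 4 * 1 := (mul_one _).symm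
        _ ≤ (T : ℝ) ^ 4 * T := mul_le_mul_of_nonneg_left hT1' hT4.le
        _ = (T : ℝ) ^ 5 := by ring
    have h0 : 0 ≤ 1 / π ^ 2 / (T : ℝ) ^ 4 := by positivity
    calc |@Literature.MathematicalPhysics.QuantumFieldTheory.curvaturePlaquetteCorr 4 (by norm_num) (T : ℤ)|
        ≤ |@Literature.MathematicalPhysics.QuantumFieldTheory.curvaturePlaquetteCorr 4 (by norm_num) (T : ℤ) - 1 / π ^ 2 / (T : ℝ) ^ 4| +
            |1 / π ^ 2 / (T : ℝ) ^ 4| := by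
          have := abs_sub_abs_le_abs_sub (@Literature.MathematicalPhysics.QuantumFieldTheory.curvaturePlaquetteCorr 4 (by norm_num) (T : ℤ))
            (1 / π ^ 2 / (T : ℝ) ^ 4)
          linarith
      _ ≤ K_C / (T : ℝ) ^ 5 + 1 / π ^ 2 / (T : ℝ) ^ 4 := by rw [abs_of_nonneg h0]; gcongr
      _ ≤ K_C / (T : ℝ) ^ 4 + 1 / π ^ 2 / (T : ℝ) ^ 4 := by linarith
      _ = κ₀ / (T : ℝ) ^ 4 := by rw [hκ₀]; ring
  -- assemble: `c · C² ≤ η · boxDirCircSqCov H T ≤ β² · boxPlaqCov`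
  have hrelβ := h₁ β hββ₁
  have hWick : boxDirCircSqCov H T = 2 * boxDirichletPlaqCov H T ^ 2 := boxDirCircSqCov_eq_two_mul_sq H T
  have hC2 : @Literature.MathematicalPhysics.QuantumFieldTheory.curvaturePlaquetteCorr 4 (by norm_num) (T : ℤ) ^ 2 ≤ (κ₀ / (T : ℝ) ^ 4) ^ 2 := by
    rw [← sq_abs]
    exact pow_le_pow_left₀ (abs_nonneg _) hCabs 2
  have hP2 : (1 / (4 * π ^ 2) / (T : ℝ) ^ 4) ^ 2 ≤ boxDirichletPlaqCov H T ^ 2 := pow_le_pow_left₀ hPpos.le hP 2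
  have hkey : c * @Literature.MathematicalPhysics.QuantumFieldTheory.curvaturePlaquetteCorr 4 (by norm_num) (T : ℤ) ^ 2 ≤
      η * boxDirCircSqCov H T := by
    rw [hWick]
    have hT4 : (0 : ℝ) < (T : ℝ) ^ 4 := by positivity
    have e1 : c * (κ₀ / (T : ℝ) ^ 4) ^ 2 = η * (2 * (1 / (4 * π ^ 2) / (T : ℝ) ^ 4) ^ 2) := by
      rw [hc]; field_simp; ring
    calc c * @Literature.MathematicalPhysics.QuantumFieldTheory.curvaturePlaquetteCorr 4 (by norm_num) (T : ℤ) ^ 2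
        ≤ c * (κ₀ / (T : ℝ) ^ 4) ^ 2 := mul_le_mul_of_nonneg_left hC2 hcpos.le
      _ = η * (2 * (1 / (4 * π ^ 2) / (T : ℝ) ^ 4) ^ 2) := e1
      _ ≤ η * (2 * boxDirichletPlaqCov H T ^ 2) := by gcongr
  exact hkey.trans hrelβ

/-- **The relative sandwich at an arbitrary ceiling `θc`, cold-wall `SU(2)` box, fundamental representation.**  If for every `0 < θ ≤ θc` some
`η > 0` bounds `β²·boxPlaqCov` from below by `η·boxDirCircSqCov` eventually in `β` at every separation `T ≤ ⌈β^θ⌉`, then for all `0 < A < θ ≤ θc`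
some `c > 0` has `BoxTwoPointDomination (fundamentalRep (Fin 2)) A θ c` — the T-respecting currency: no `κ > 8θ`.  NOT the Clay mass gap. -/
theorem boxWindow_of_dirichletDominationRel_ceiling (θc : ℝ)
    (h : ∀ θ : ℝ, 0 < θ → θ ≤ θc → ∃ η : ℝ, 0 < η ∧ ∃ β₀ : ℝ, ∀ β : ℝ, β₀ ≤ β → ∀ T : ℕ, T ≤ ⌈β ^ θ⌉₊ →
      η * boxDirCircSqCov ⌈β ^ θ⌉₊ T ≤
        β ^ 2 * boxPlaqCov (G := Matrix.specialUnitaryGroup (Fin 2) ℂ) (fundamentalRep (Fin 2)) β ⌈β ^ θ⌉₊ T) :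
    ∀ A θ : ℝ, 0 < A → A < θ → θ ≤ θc → ∃ c : ℝ, 0 < c ∧
      BoxTwoPointDomination (G := Matrix.specialUnitaryGroup (Fin 2) ℂ) (fundamentalRep (Fin 2)) A θ c := by
  intro A θ hA hAθ hθc
  have hθ : 0 < θ := hA.trans hAθ
  obtain ⟨η, hη, β₀, h₀⟩ := h θ hθ hθc
  refine boxTwoPointDomination_of_relDir_at (fundamentalRep (Fin 2)) hη hA hAθ ⟨max β₀ 1, fun β hβ => ?_⟩
  have hβ1 : 1 ≤ β := le_trans (le_max_right _ _) hβ
  exact h₀ β (le_trans (le_max_left _ _) hβ) ⌈β ^ A⌉₊ (Nat.ceil_mono (Real.rpow_le_rpow_of_exponent_le hβ1 hAθ.le))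

end Summit.QuantumFields.YangMills.Theorems.AllWindowsColdBox

end
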